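import Summits.Ventures.PercRepro.S1CellQ

/-!
# PercRepro — LEMMA R: the triangle count by the size of the ground set; the cells `(8, 28)`, `(8, 29)` (p2, gen 17)

Under (C1) the triangles through a point `x` meet pairwise only in `x` (night-1's
`eRk_le_and_ncard_eq_of_triangles`: `t` of them cover `1 + 2t` points), so `t(x) ≤ ⌊(|E| − 1)/2⌋`, and the
double count `3·s₃ = Σ_x t(x)` gives `3·s₃ ≤ |E|·⌊(|E| − 1)/2⌋` — in a cell `(p, d)` of the `q = 4` window a bound
in `n = p + d` that beats every bound in the nullity at large corank: `204` at `n = 36` and `222` at `n = 37`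
against `(d² − 3d + 6)/2 = 353 / 380` at `d = 28 / 29`. It closes the cells `(8, 28)` (twin `1.1105 → 0.9619`) and
`(8, 29)` (`1.0551 → 0.896`) of the row `p = 8`.

* `three_mul_ncard_triangles_le_mul` — the double count `3·s₃ ≤ |E|·k` when every point lies on `≤ k` triangles;
* **`three_mul_ncard_triangles_le_mul_div`** — LEMMA R: `3·s₃ ≤ |E|·⌊(|E| − 1)/2⌋` under (C1);
* `cell_eight_twentyeight_r`, `cell_eight_twentynine_r` — the two kernel cells;
* **`c025_core_eight_twentyeight`**, **`c025_core_eight_twentynine`** — the cores of rank `8` with `36` / `37` points.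
Axioms: standard.
-/

open scoped Matroid

namespace PercRepro

namespace S1

open Set

variable {α : Type}

/-- **Double count, upper bound**: if every point of `E` lies on at most `k` triangles then `3·s₃ ≤ |E|·k`. -/
theorem three_mul_ncard_triangles_le_mul (M : Matroid α) [M.Finite] (k : ℕ)
    (hdeg : ∀ x ∈ M.E, (ThmN.trianglesThrough M x).ncard ≤ k) :
    3 * (ThmN.triangles M).ncard ≤ M.E.ncard * k := by
  classical
  have hTfin : (ThmN.triangles M).Finite :=
    M.ground_finite.finite_subsets.subset (fun C hC => hC.1.subset_ground)
  set Tf : Finset (Set α) := hTfin.toFinset with hTf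
  set Ef : Finset α := M.ground_finite.toFinset with hEf
  have hmemT : ∀ C, C ∈ Tf ↔ C ∈ ThmN.triangles M := fun C => Set.Finite.mem_toFinset hTfin
  have hmemE : ∀ x, x ∈ Ef ↔ x ∈ M.E := fun x => Set.Finite.mem_toFinset M.ground_finite
  have hswap : ∑ x ∈ Ef, ∑ C ∈ Tf, (if x ∈ C then 1 else 0) =
      ∑ C ∈ Tf, ∑ x ∈ Ef, (if x ∈ C then 1 else 0) := Finset.sum_comm
  have hrow : ∀ C ∈ Tf, ∑ x ∈ Ef, (if x ∈ C then 1 else 0) = 3 := by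
    intro C hC
    rw [Finset.sum_boole, Nat.cast_id]
    have hCT : C ∈ ThmN.triangles M := (hmemT C).1 hC
    have hCfin : C.Finite := M.ground_finite.subset hCT.1.subset_ground
    have hfilter : (Ef.filter (fun x => x ∈ C)) = hCfin.toFinset := by
      ext x
      simp only [Finset.mem_filter, Set.Finite.mem_toFinset]
      constructor
      · rintro ⟨-, hx⟩; exact hx
      · intro hx
        exact ⟨(hmemE x).2 (hCT.1.subset_ground hx), hx⟩
    rw [hfilter, ← Set.ncard_eq_toFinset_card C hCfin, hCT.2]
  have hcol : ∀ x ∈ Ef, ∑ C ∈ Tf, (if x ∈ C then 1 else 0) ≤ k := by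
    intro x hx
    rw [Finset.sum_boole, Nat.cast_id]
    have hfilter : ((Tf.filter (fun C => x ∈ C)) : Set (Set α)) = ThmN.trianglesThrough M x := by
      ext C
      simp only [Finset.coe_filter, Set.mem_setOf_eq, hmemT, ThmN.triangles, ThmN.trianglesThrough]
      tauto
    have hcard : (Tf.filter (fun C => x ∈ C)).card = (ThmN.trianglesThrough M x).ncard := by
      rw [← hfilter, Set.ncard_coe_finset]
    rw [hcard]
    exact hdeg x ((hmemE x).1 hx)
  have hleft : ∑ C ∈ Tf, ∑ x ∈ Ef, (if x ∈ C then 1 else 0) = 3 * (ThmN.triangles M).ncard := by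
    rw [Finset.sum_congr rfl hrow, Finset.sum_const, smul_eq_mul, hTf,
      ← Set.ncard_eq_toFinset_card _ hTfin, mul_comm]
  have hright : ∑ x ∈ Ef, ∑ C ∈ Tf, (if x ∈ C then 1 else 0) ≤ M.E.ncard * k := by
    calc ∑ x ∈ Ef, ∑ C ∈ Tf, (if x ∈ C then 1 else 0) ≤ ∑ _x ∈ Ef, k := Finset.sum_le_sum hcol
      _ = M.E.ncard * k := by
        rw [Finset.sum_const, smul_eq_mul, hEf, ← Set.ncard_eq_toFinset_card _ M.ground_finite]
  rw [← hleft, ← hswap]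
  exact hright

/-- **LEMMA R**: under (C1), `3·s₃ ≤ |E|·⌊(|E| − 1)/2⌋` — the triangles through a point meet pairwise only in
that point, so at most `⌊(|E| − 1)/2⌋` pass through it. -/
theorem three_mul_ncard_triangles_le_mul_div (M : Matroid α) [M.Finite]
    (hC1 : ∀ L ⊆ M.E, M.eRk L = 2 → L.ncard ≤ 3) :
    3 * (ThmN.triangles M).ncard ≤ M.E.ncard * ((M.E.ncard - 1) / 2) := by
  classical
  refine three_mul_ncard_triangles_le_mul M _ ?_
  intro x hxE
  have hTfin : (ThmN.trianglesThrough M x).Finite :=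
    M.ground_finite.finite_subsets.subset (fun C hC => hC.1.subset_ground)
  by_cases h0 : (ThmN.trianglesThrough M x).ncard = 0
  · rw [h0]; exact Nat.zero_le _
  -- `x` lies on a triangle, so it is a non-loop
  obtain ⟨C₀, hC₀⟩ : (ThmN.trianglesThrough M x).Nonempty := by
    rw [← Set.ncard_pos hTfin]; omega
  have hx : M.IsNonloop x := by
    rw [← _root_.Matroid.indep_singleton]
    refine hC₀.1.ssubset_indep ?_
    refine (Set.singleton_subset_iff.2 hC₀.2.2).ssubset_of_ne ?_
    intro h
    have := congrArg Set.ncard h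
    rw [Set.ncard_singleton, hC₀.2.1] at this
    omega
  -- the triangles through `x` cover `1 + 2t` points of `E`
  set s := hTfin.toFinset with hs
  have hsmem : ∀ C ∈ s, C ∈ ThmN.trianglesThrough M x := fun C hC => (Set.Finite.mem_toFinset hTfin).1 hC
  have hcover := (ThmN.eRk_le_and_ncard_eq_of_triangles M hC1 hx s hsmem).2
  have hscard : s.card = (ThmN.trianglesThrough M x).ncard := by
    rw [hs, ← Set.ncard_eq_toFinset_card _ hTfin]
  have hsub : ({x} ∪ ⋃ C ∈ s, C) ⊆ M.E := by
    refine Set.union_subset (Set.singleton_subset_iff.2 hxE) ?_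
    intro y hy
    simp only [Set.mem_iUnion] at hy
    obtain ⟨C, hC, hyC⟩ := hy
    exact (hsmem C hC).1.subset_ground hyC
  have hle : ({x} ∪ ⋃ C ∈ s, C).ncard ≤ M.E.ncard := Set.ncard_le_ncard hsub M.ground_finite
  rw [hcover, hscard] at hle
  omega

/-- The cell `(8, 28)` with `s₃ ≤ 204` (LEMMA R at `n = 36`) and `s₄ ≤ C(31, 4) = 31465`. -/
theorem cell_eight_twentyeight_r : cellOK10 8 28 204 31465 = true := by decide +kernel

/-- The cell `(8, 29)` with `s₃ ≤ 222` (LEMMA R at `n = 37`) and `s₄ ≤ C(32, 4) = 35960`. -/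
theorem cell_eight_twentynine_r : cellOK10 8 29 222 35960 = true := by decide +kernel

/-- **THE CELL `(8, 28)`**: an `e`-free core of rank `8` with `36` points satisfies `RLS` at level `4`. -/
theorem c025_core_eight_twentyeight (M : Matroid α) [M.Finite] (hR : M.eRank = (8 : ℕ)) (hn : M.E.ncard = 36)
    (hfree : ∀ e ∈ M.E, ∃ A ⊆ M.E \ {e}, e ∉ M.closure A ∧ e ∉ M.closure ((M.E \ {e}) \ A)) :
    ThmN.RLS M 8 4 := by
  have hd : M.E.encard = M.eRank + ((28 : ℕ) : ℕ∞) := by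
    rw [hR, ← M.ground_finite.cast_ncard_eq, hn]
    push_cast
    ring
  have hL : ∀ e ∈ M.E, ¬ M.IsLoop e := ThmN.not_isLoop_of_free M hfree
  have hline : ∀ L ⊆ M.E, M.eRk L = 2 → L.ncard ≤ 3 := by
    intro L hL' hr
    have := ThmN.ncard_add_one_le_two_pow_of_eRk_le M hL hfree 2 L hL' hr.le
    omega
  have hP : {C : Set α | M.IsCircuit C ∧ C.ncard = 3}.ncard ≤ 204 := by
    have h := three_mul_ncard_triangles_le_mul_div M hline
    rw [hn] at h
    have h' : 3 * {C : Set α | M.IsCircuit C ∧ C.ncard = 3}.ncard ≤ 36 * ((36 - 1) / 2) := h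
    omega
  have hS : {C : Set α | M.IsCircuit C ∧ C.ncard = 4}.ncard ≤ 31465 :=
    (ncard_fourCircuits_le_choose M hd).trans (by decide +kernel)
  exact rls_of_cellOK10 M 8 28 204 31465 (by norm_num) hR hn hfree hP hS (by norm_num) cell_eight_twentyeight_r

/-- **THE CELL `(8, 29)`**: an `e`-free core of rank `8` with `37` points satisfies `RLS` at level `4`. -/
theorem c025_core_eight_twentynine (M : Matroid α) [M.Finite] (hR : M.eRank = (8 : ℕ)) (hn : M.E.ncard = 37)
    (hfree : ∀ e ∈ M.E, ∃ A ⊆ M.E \ {e}, e ∉ M.closure A ∧ e ∉ M.closure ((M.E \ {e}) \ A)) :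
    ThmN.RLS M 8 4 := by
  have hd : M.E.encard = M.eRank + ((29 : ℕ) : ℕ∞) := by
    rw [hR, ← M.ground_finite.cast_ncard_eq, hn]
    push_cast
    ring
  have hL : ∀ e ∈ M.E, ¬ M.IsLoop e := ThmN.not_isLoop_of_free M hfree
  have hline : ∀ L ⊆ M.E, M.eRk L = 2 → L.ncard ≤ 3 := by
    intro L hL' hr
    have := ThmN.ncard_add_one_le_two_pow_of_eRk_le M hL hfree 2 L hL' hr.le
    omega
  have hP : {C : Set α | M.IsCircuit C ∧ C.ncard = 3}.ncard ≤ 222 := by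
    have h := three_mul_ncard_triangles_le_mul_div M hline
    rw [hn] at h
    have h' : 3 * {C : Set α | M.IsCircuit C ∧ C.ncard = 3}.ncard ≤ 37 * ((37 - 1) / 2) := h
    omega
  have hS : {C : Set α | M.IsCircuit C ∧ C.ncard = 4}.ncard ≤ 35960 :=
    (ncard_fourCircuits_le_choose M hd).trans (by decide +kernel)
  exact rls_of_cellOK10 M 8 29 222 35960 (by norm_num) hR hn hfree hP hS (by norm_num) cell_eight_twentynine_r

end S1

end PercRepro
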